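import Summits.ABC.ABC.Theses.DefiniteXi
import Literature.NumberTheory.EllipticCurves.SerreFreyValuationProductProofs
import Literature.Barriers.ABC.EpsilonCannotBeDroppedPolylog

/-!
# `SteinbergCore` (stmt-ABC-15024) — negative-side lemmas III: the exponent product is not polylogarithmic

The crux multiplies the prime-to-6 part of `ξ` by the FULL exponent product
`T(E) = ∏_{q ∣ N} v_q(Δ_min(E_(a,b)))`; the route argues `T = N^(o(1))` UNDER SZPIRO (`Σ v_q log q ≤ (6+ε) log N`).
Refuted natural strengthening (unconditional, explicit family): `T(E)` is NOT `O((log N)^A)` on Frey curves for any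
fixed `A`:

* `not_tamProd_freyCurve_le_polylog` — `¬ ∃ A C, ∀ coprime a b (ab(a+b) ≠ 0), T(E_(a,b)) ≤ C (log N)^A`.

Family: `a = -1`, `b = 32 Q`, `Q = ∏_{i<s} p_{i+1}^j` (`p_1 = 3, p_2 = 5, …` the odd primes, `s = ⌊A⌋ + 2`,
`j → ∞`): Serre-normalised (`a ≡ -1 (4)`, `32 ∣ b`), so `N = rad(32 Q (32Q-1)) ≤ 2^10 P^(2j)` (`P = ∏ p_{i+1}`) and
`v_q(Δ_min) = 2 v_q(32Q(32Q-1)) - 8[q=2]` (tree: `conductorNorm_freyCurve_serre`,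
`factorization_minimalDiscriminantNorm_freyCurve_serre`), whence `T ≥ (2j)^s` while `log N ≤ 2 j log P + 10 log 2`.
So the `T`-factor of the crux genuinely costs `exp(Θ(log N / log log N))` on thin families; any proof must carry it
at scale `N^ε`, exactly as the crux is stated (and as Pasten's theorem `T ≪ N^(8/3+ε)` does).

Refuter seat refuter-cdisprove-stmt-ABC-15024-0, 2026-08-16.
-/

-- `Summit.<Summit>.<Problem>` is the mandated summit-side namespace; for the single-conjunct summit `ABC` the
-- duplicate `ABC.ABC` is deliberate.
set_option linter.dupNamespace false

noncomputable section

open scoped BigOperators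
open Literature.NumberTheory.EllipticCurves Literature.Barriers.ABC UniqueFactorizationMonoid

namespace Summit.ABC.ABC.Theorems.SteinbergCore.Negative

/-- The odd prime power product `Q = ∏_{i<s} p_{i+1}^j`. (local abbreviation inside proofs only) -/
theorem prod_nth_prime_succ_pow_const_eq_pow (s j : ℕ) :
    (∏ i : Fin s, Nat.nth Nat.Prime (i + 1) ^ j) = (∏ i : Fin s, Nat.nth Nat.Prime (i + 1)) ^ j :=
  Finset.prod_pow _ _ _

/-- `3 ≤ P = ∏_{i<s} p_{i+1}` for `s ≥ 1` (the factor `p_1 = 3`). [folklore] -/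
theorem three_le_prod_nth_prime_succ' {s : ℕ} (hs : 1 ≤ s) :
    3 ≤ ∏ i : Fin s, Nat.nth Nat.Prime (i + 1) := by
  have h3 : Nat.nth Nat.Prime ((⟨0, hs⟩ : Fin s) + 1) = 3 := by
    simp [Nat.nth_prime_one_eq_three]
  calc 3 = Nat.nth Nat.Prime ((⟨0, hs⟩ : Fin s) + 1) := h3.symm
    _ ≤ ∏ i : Fin s, Nat.nth Nat.Prime (i + 1) :=
        Finset.single_le_prod' (f := fun i : Fin s => Nat.nth Nat.Prime (i + 1))
          (fun i _ => (Nat.prime_nth_prime _).one_lt.le) (Finset.mem_univ (⟨0, hs⟩ : Fin s))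

/-- **`T(E)` is not polylogarithmic on Frey curves.**  For every `A, C` there is a coprime pair (`a = -1`,
`b = 32 ∏_{i<s} p_{i+1}^j`) with `T(E_(a,b)) = ∏_{q ∣ N} v_q(Δ_min) > C (log N)^A`. [folklore] -/
theorem not_tamProd_freyCurve_le_polylog :
    ¬ ∃ A C : ℝ, ∀ a b : ℤ, IsCoprime a b → a * b * (a + b) ≠ 0 →
      ((∏ q ∈ ((freyCurve a b).conductorNorm ℤ).primeFactors,
          ((freyCurve a b).minimalDiscriminantNorm ℤ).factorization q : ℕ) : ℝ) ≤
        C * Real.log ((freyCurve a b).conductorNorm ℤ) ^ A := by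
  rintro ⟨A, C, h⟩
  -- WLOG `A ≥ 0`, `C ≥ 0`
  set A' : ℝ := max A 0 with hA'
  set C' : ℝ := max C 0 with hC'
  have hA'0 : 0 ≤ A' := le_max_right _ _
  have hC'0 : 0 ≤ C' := le_max_right _ _
  -- number of primes in the family
  set s : ℕ := ⌊A'⌋₊ + 2 with hs
  have hs1 : 1 ≤ s := by omega
  have hsA : A' + 1 ≤ (s : ℝ) := by
    have := Nat.lt_floor_add_one A'
    rw [hs]; push_cast; linarith
  set P : ℕ := ∏ i : Fin s, Nat.nth Nat.Prime (i + 1) with hP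
  have hP3 : 3 ≤ P := three_le_prod_nth_prime_succ' hs1
  have hP0 : 0 < P := by omega
  set L : ℝ := Real.log P with hL
  have hL0 : 0 < L := Real.log_pos (by exact_mod_cast (show 1 < P by omega))
  set c₀ : ℝ := Real.log 1024 with hc₀
  have hc₀0 : 0 ≤ c₀ := Real.log_nonneg (by norm_num)
  -- the key estimate at exponent `j ≥ 1`: `(2j)^s ≤ T ≤ C' (c₀ + 2 j L)^A'`
  have key : ∀ j : ℕ, 1 ≤ j → ((2 * j) ^ s : ℝ) ≤ C' * (c₀ + 2 * j * L) ^ A' := by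
    intro j hj
    set Q : ℕ := ∏ i : Fin s, Nat.nth Nat.Prime (i + 1) ^ j with hQ
    have hQP : Q = P ^ j := prod_nth_prime_succ_pow_const_eq_pow s j
    have hQ0 : 0 < Q := prod_nth_prime_succ_pow_pos _
    have hQodd : ¬ 2 ∣ Q := by
      rw [hQP]; exact fun h2 => not_two_dvd_prod_nth_prime_succ s (Nat.prime_two.dvd_of_dvd_pow h2)
    -- the pair
    set a : ℤ := -1 with ha
    set b : ℤ := 32 * Q with hb
    have hab : IsCoprime a b := isCoprime_one_left.neg_left
    have hmZ : a * b * (a + b) = -((32 * Q * (32 * Q - 1) : ℕ) : ℤ) := by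
      have h1 : 1 ≤ 32 * Q := by omega
      rw [ha, hb]; push_cast [Nat.cast_sub h1]; ring
    set m : ℕ := 32 * Q * (32 * Q - 1) with hm
    have hm0 : m ≠ 0 := by
      have : 1 ≤ 32 * Q - 1 := by omega
      positivity
    have h0 : a * b * (a + b) ≠ 0 := by
      rw [hmZ, neg_ne_zero]; exact_mod_cast hm0
    have hmod : a ≡ -1 [ZMOD 4] := Int.ModEq.refl _
    have h32 : (32 : ℤ) ∣ b := Dvd.intro _ rfl
    have hnat : (a * b * (a + b)).natAbs = m := by rw [hmZ, Int.natAbs_neg, Int.natAbs_natCast]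
    -- conductor and exponents in Serre's normalisation
    have hN : (freyCurve a b).conductorNorm ℤ = radical m := by
      rw [conductorNorm_freyCurve_serre hab h0 hmod h32, hnat]
    have hfac : ∀ p : ℕ, ((freyCurve a b).minimalDiscriminantNorm ℤ).factorization p =
        2 * m.factorization p - if p = 2 then 8 else 0 := by
      intro p; rw [factorization_minimalDiscriminantNorm_freyCurve_serre hab h0 hmod h32 p, hnat]
    have hpf : ((freyCurve a b).conductorNorm ℤ).primeFactors = m.primeFactors := by
      rw [hN, Nat.primeFactors_radical]
    -- `v_2(m) = 5`
    have hodd' : ¬ 2 ∣ 32 * Q - 1 := by omega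
    have hm2 : m.factorization 2 = 5 := by
      have h32Q : (32 * Q).factorization 2 = 5 := by
        rw [Nat.factorization_mul (by norm_num) hQ0.ne', Finsupp.add_apply,
          Nat.factorization_eq_zero_of_not_dvd hQodd, add_zero,
          show (32 : ℕ) = 2 ^ 5 by norm_num, Nat.prime_two.factorization_pow]
        simp
      rw [hm, Nat.factorization_mul (by omega) (by omega), Finsupp.add_apply, h32Q,
        Nat.factorization_eq_zero_of_not_dvd hodd', add_zero]
    -- every factor of `T` is `≥ 1`, and the factor at `p_{i+1}` is `≥ 2 j`
    have hge1 : ∀ q ∈ m.primeFactors, 1 ≤ 2 * m.factorization q - if q = 2 then 8 else 0 := by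
      intro q hq
      obtain ⟨hqp, hqd, -⟩ := Nat.mem_primeFactors.mp hq
      by_cases hq2 : q = 2
      · subst hq2; simp [hm2]
      · rw [if_neg hq2]; have := hqp.factorization_pos_of_dvd hm0 hqd; omega
    have hQm : Q ∣ m := ⟨32 * (32 * Q - 1), by rw [hm]; ring⟩
    have hvQ : ∀ i : Fin s, Q.factorization (Nat.nth Nat.Prime (i + 1)) = j := fun i =>
      factorization_prod_nth_prime_succ_pow (fun _ => j) i
    have hgej : ∀ i : Fin s, 2 * j ≤ 2 * m.factorization (Nat.nth Nat.Prime (i + 1)) -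
        if Nat.nth Nat.Prime (i + 1) = 2 then 8 else 0 := by
      intro i
      have hne2 : Nat.nth Nat.Prime (i + 1) ≠ 2 := (two_lt_nth_prime_succ i).ne'
      rw [if_neg hne2, Nat.sub_zero]
      have hle : Q.factorization (Nat.nth Nat.Prime (i + 1)) ≤ m.factorization (Nat.nth Nat.Prime (i + 1)) :=
        (Nat.factorization_le_iff_dvd hQ0.ne' hm0).mpr hQm _
      rw [hvQ i] at hle
      omega
    -- the set of family primes inside `m.primeFactors`
    set S : Finset ℕ := Finset.univ.image fun i : Fin s => Nat.nth Nat.Prime (i + 1) with hSdef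
    have hinj : Function.Injective fun i : Fin s => Nat.nth Nat.Prime (i + 1) := by
      intro i i' hii'
      exact Fin.ext (by simpa using (Nat.nth_injective Nat.infinite_setOf_prime) hii')
    have hSsub : S ⊆ m.primeFactors := by
      intro q hq
      obtain ⟨i, -, rfl⟩ := Finset.mem_image.mp hq
      refine Nat.mem_primeFactors.mpr ⟨Nat.prime_nth_prime _, ?_, hm0⟩
      have : Nat.nth Nat.Prime (i + 1) ∣ Q :=
        (dvd_pow_self _ (by omega : j ≠ 0)).trans
          (Finset.dvd_prod_of_mem (fun i : Fin s => Nat.nth Nat.Prime (i + 1) ^ j) (Finset.mem_univ i))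
      exact this.trans hQm
    have hT : (2 * j) ^ s ≤ ∏ q ∈ m.primeFactors, (2 * m.factorization q - if q = 2 then 8 else 0) := by
      calc (2 * j) ^ s = ∏ _i : Fin s, (2 * j) := by simp [Finset.prod_const]
        _ ≤ ∏ i : Fin s, (2 * m.factorization (Nat.nth Nat.Prime (i + 1)) -
              if Nat.nth Nat.Prime (i + 1) = 2 then 8 else 0) :=
            Finset.prod_le_prod' fun i _ => hgej i
        _ = ∏ q ∈ S, (2 * m.factorization q - if q = 2 then 8 else 0) := by
            rw [hSdef, Finset.prod_image fun i _ i' _ h => hinj h]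
        _ ≤ ∏ q ∈ m.primeFactors, (2 * m.factorization q - if q = 2 then 8 else 0) :=
            Finset.prod_le_prod_of_subset_of_one_le' hSsub fun q hq _ => hge1 q hq
    -- `T(E_(a,b))` rewritten
    have hTE : (∏ q ∈ ((freyCurve a b).conductorNorm ℤ).primeFactors,
        ((freyCurve a b).minimalDiscriminantNorm ℤ).factorization q) =
        ∏ q ∈ m.primeFactors, (2 * m.factorization q - if q = 2 then 8 else 0) := by
      rw [hpf]; exact Finset.prod_congr rfl fun q _ => hfac q
    -- the bound from the hypothesis, with `A', C'`
    have hinst := h a b hab h0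
    rw [hTE] at hinst
    -- size of `N`: `3 ≤ N ≤ 1024 P^(2j)`
    haveI := isElliptic_freyCurve h0
    have hNpos : 0 < (freyCurve a b).conductorNorm ℤ := WeierstrassCurve.conductorNorm_pos_holds _
    have hNle : ((freyCurve a b).conductorNorm ℤ : ℝ) ≤ 1024 * (P : ℝ) ^ (2 * j) := by
      have h1 : (freyCurve a b).conductorNorm ℤ ≤ m := by
        rw [hN]; exact Nat.le_of_dvd (Nat.pos_of_ne_zero hm0) radical_dvd_self
      have h2 : m ≤ 1024 * P ^ (2 * j) := by
        have : 32 * Q * (32 * Q - 1) ≤ 32 * Q * (32 * Q) := Nat.mul_le_mul_left _ (Nat.sub_le _ _)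
        calc m = 32 * Q * (32 * Q - 1) := hm
          _ ≤ 32 * Q * (32 * Q) := this
          _ = 1024 * P ^ (2 * j) := by rw [hQP]; ring
      exact_mod_cast h1.trans h2
    have hN3 : 3 ≤ (freyCurve a b).conductorNorm ℤ := by
      have h3P : 3 ∣ P := by
        have : Nat.nth Nat.Prime ((⟨0, hs1⟩ : Fin s) + 1) ∣ P :=
          Finset.dvd_prod_of_mem (fun i : Fin s => Nat.nth Nat.Prime (i + 1)) (Finset.mem_univ _)
        simpa [Nat.nth_prime_one_eq_three] using this
      have h3Q : 3 ∣ Q := hQP ▸ h3P.trans (dvd_pow_self P (by omega))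
      have h3m : 3 ∣ m := h3Q.trans hQm
      have h3N : 3 ∣ (freyCurve a b).conductorNorm ℤ := by
        rw [hN]; exact (dvd_radical_iff_of_irreducible Nat.prime_three hm0).mpr h3m
      exact Nat.le_of_dvd hNpos h3N
    -- logarithms
    have hNposR : (0 : ℝ) < ((freyCurve a b).conductorNorm ℤ : ℝ) := by exact_mod_cast hNpos
    have hlog1 : 1 ≤ Real.log ((freyCurve a b).conductorNorm ℤ : ℝ) := by
      have h3 : Real.exp 1 < 3 := lt_trans Real.exp_one_lt_d9 (by norm_num)
      have : (3 : ℝ) ≤ ((freyCurve a b).conductorNorm ℤ : ℝ) := by exact_mod_cast hN3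
      exact ((Real.lt_log_iff_exp_lt hNposR).mpr (h3.trans_le this)).le
    have hlog0 : 0 ≤ Real.log ((freyCurve a b).conductorNorm ℤ : ℝ) := zero_le_one.trans hlog1
    have hlogle : Real.log ((freyCurve a b).conductorNorm ℤ : ℝ) ≤ c₀ + 2 * j * L := by
      have hP0R : (0 : ℝ) < (P : ℝ) := by exact_mod_cast hP0
      calc Real.log ((freyCurve a b).conductorNorm ℤ : ℝ) ≤ Real.log (1024 * (P : ℝ) ^ (2 * j)) :=
            Real.log_le_log hNposR hNle
        _ = c₀ + 2 * j * L := by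
            rw [Real.log_mul (by norm_num) (pow_ne_zero _ hP0R.ne'), Real.log_pow]; push_cast; ring
    -- assemble
    have hTR : ((2 * j) ^ s : ℝ) ≤ ((∏ q ∈ m.primeFactors, (2 * m.factorization q - if q = 2 then 8 else 0) : ℕ) : ℝ) := by
      exact_mod_cast hT
    refine hTR.trans (hinst.trans ?_)
    have hrA : Real.log ((freyCurve a b).conductorNorm ℤ : ℝ) ^ A ≤
        Real.log ((freyCurve a b).conductorNorm ℤ : ℝ) ^ A' :=
      Real.rpow_le_rpow_of_exponent_le hlog1 (le_max_left _ _)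
    have hrA' : Real.log ((freyCurve a b).conductorNorm ℤ : ℝ) ^ A' ≤ (c₀ + 2 * j * L) ^ A' :=
      Real.rpow_le_rpow hlog0 hlogle hA'0
    have hr0 : 0 ≤ Real.log ((freyCurve a b).conductorNorm ℤ : ℝ) ^ A := Real.rpow_nonneg hlog0 _
    calc C * Real.log ((freyCurve a b).conductorNorm ℤ : ℝ) ^ A
        ≤ C' * Real.log ((freyCurve a b).conductorNorm ℤ : ℝ) ^ A := mul_le_mul_of_nonneg_right (le_max_left _ _) hr0
      _ ≤ C' * (c₀ + 2 * j * L) ^ A' := mul_le_mul_of_nonneg_left (hrA.trans hrA') hC'0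
  -- endgame: `j^(A'+1) ≤ (2j)^s ≤ K j^A'` is impossible for `j > K`
  set K : ℝ := C' * (c₀ + 2 * L) ^ A' with hK
  have hK0 : 0 ≤ K := mul_nonneg hC'0 (Real.rpow_nonneg (by positivity) _)
  set j : ℕ := ⌊K⌋₊ + 1 with hj
  have hj1 : 1 ≤ j := by omega
  have hjK : K < (j : ℝ) := by rw [hj]; push_cast; exact Nat.lt_floor_add_one K
  have hjpos : (0 : ℝ) < (j : ℝ) := by exact_mod_cast (show 0 < j by omega)
  have hj1R : (1 : ℝ) ≤ (j : ℝ) := by exact_mod_cast hj1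
  have hkey := key j hj1
  -- RHS ≤ K · j^A'
  have hRHS : C' * (c₀ + 2 * j * L) ^ A' ≤ K * (j : ℝ) ^ A' := by
    have hle : c₀ + 2 * j * L ≤ (j : ℝ) * (c₀ + 2 * L) := by nlinarith
    have hnn : (0 : ℝ) ≤ c₀ + 2 * j * L := by positivity
    calc C' * (c₀ + 2 * j * L) ^ A' ≤ C' * ((j : ℝ) * (c₀ + 2 * L)) ^ A' :=
          mul_le_mul_of_nonneg_left (Real.rpow_le_rpow hnn hle hA'0) hC'0
      _ = K * (j : ℝ) ^ A' := by
          rw [Real.mul_rpow hjpos.le (by positivity), hK]; ring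
  -- LHS ≥ j^A' · j
  have hLHS : (j : ℝ) ^ A' * j ≤ ((2 * j) ^ s : ℝ) := by
    have h1 : (j : ℝ) ^ A' * j = (j : ℝ) ^ (A' + 1) := (Real.rpow_add_one hjpos.ne' A').symm
    have h2 : (j : ℝ) ^ (A' + 1) ≤ (j : ℝ) ^ (s : ℝ) := Real.rpow_le_rpow_of_exponent_le hj1R hsA
    have h3 : (j : ℝ) ^ (s : ℝ) = (j : ℝ) ^ s := Real.rpow_natCast _ _
    have h4 : ((j : ℝ)) ^ s ≤ ((2 * j) ^ s : ℝ) := by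
      gcongr; linarith
    linarith [h1, h2, h3, h4]
  have hfin : (j : ℝ) ^ A' * j ≤ (j : ℝ) ^ A' * K := by
    calc (j : ℝ) ^ A' * j ≤ K * (j : ℝ) ^ A' := hLHS.trans (hkey.trans hRHS)
      _ = (j : ℝ) ^ A' * K := mul_comm _ _
  have hjA : (0 : ℝ) < (j : ℝ) ^ A' := Real.rpow_pos_of_pos hjpos _
  exact (not_le.mpr hjK) (le_of_mul_le_mul_left hfin hjA)

end Summit.ABC.ABC.Theorems.SteinbergCore.Negative
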